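import Summits.Ventures.DiscreteObjects.MOLS.PlaneOfMOLS
import Summits.Ventures.DiscreteObjects.MOLS.MOLSUpperBound

/-!
# A projective plane of order `n` exists iff `n - 1` MOLS(n) exist — every order; the MOLS(10) upper floor modulo Lam (kernel)
Framing: lottery ticket; floor = certified bounds/negative ranges.

Cell pub-namedobj (venture DiscreteObjects), target (M), designs gen 9.  `PlaneOfMOLS` / `CompleteMOLSOfPlane` proved the two
directions of Bose's equivalence for general `n` and packaged the case `n = 12` (`existsPlaneOrder12_iff_eleven_MOLS`).  This file
packages EVERY order — **`existsPlane_iff_MOLS`**: for `2 ≤ n`, a finite projective plane of order `n` exists iff there is a family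
of `n - 1` Latin squares of order `n` that are pairwise orthogonal (Literature predicates) — and draws the MOLS(10) consequences
the census floor `2 ≤ N(10) ≤ 6` quotes from print: **`nine_MOLS10_iff_plane10`** (`N(10) = 9 ⇔` a projective plane of order 10),
and **`card_MOLS10_le_eight_of_noPlane10`**: IF there is no projective plane of order 10 (Lam–Thiel–Swiercz 1989, a computer proof
outside the kernel and deliberately NOT vendored as a Literature fact — here only the HYPOTHESIS `¬ ExistsProjectivePlaneOrder 10`)
then at most 8 MOLS(10) exist.  (The printed `N(10) ≤ 6` needs in addition Bruck's 1963 net-completion theorem, not formalised.)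
Also `existsPlaneOrder12_iff : ExistsProjectivePlaneOrder12 ↔ ExistsProjectivePlaneOrder 12`.  Glue; classical; no `sorry`.
-/

namespace Summit.Ventures.DiscreteObjects.MOLS

open Function Configuration Literature.Combinatorics.Designs.LatinSquares

/-- **Typed:** a finite projective plane of order `n` exists. -/
def ExistsProjectivePlaneOrder (n : ℕ) : Prop :=
  ∃ (P L : Type) (_ : Membership P L) (_ : Fintype P) (_ : Fintype L) (_ : ProjectivePlane P L),
    ProjectivePlane.order P L = n

/-- the order-12 census statement is the case `n = 12` -/
theorem existsPlaneOrder12_iff : ExistsProjectivePlaneOrder12 ↔ ExistsProjectivePlaneOrder 12 := Iff.rfl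

/-- **Bose's equivalence, every order (kernel):** for `2 ≤ n`, a projective plane of order `n` exists iff there are `n - 1`
pairwise orthogonal Latin squares of order `n`. -/
theorem existsPlane_iff_MOLS {n : ℕ} (hn : 2 ≤ n) :
    ExistsProjectivePlaneOrder n ↔ ∃ Ls : Fin (n - 1) → Fin n → Fin n → Fin n,
      (∀ k, IsLatinSquare (Ls k)) ∧ ∀ k k', k ≠ k' → IsOrthogonalMate (Ls k) (Ls k') := by
  have h0 : 0 < n := by omega
  constructor
  · rintro ⟨P, L, _, _, _, _, hPL⟩
    obtain ⟨Ls, hL, hO⟩ := exists_complete_MOLS_of_plane (P := P) (L := L) hPL h0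
    -- reindex `{j : Fin n // j ≠ 0}` by `Fin (n - 1)` via `k ↦ k + 1`
    let e : Fin (n - 1) → {j : Fin n // j ≠ ⟨0, h0⟩} := fun k => ⟨⟨k.1 + 1, by omega⟩, by simp [Fin.ext_iff]⟩
    have he : Injective e := fun k k' h => by
      simp only [e, Subtype.mk.injEq, Fin.mk.injEq] at h
      exact Fin.ext (by omega)
    exact ⟨fun k => Ls (e k), fun k => hL _, fun k k' hkk => hO _ _ fun h => hkk (he h)⟩
  · rintro ⟨Ls, hL, hO⟩
    have hι : Fintype.card (Fin (n - 1)) + 1 = n := by rw [Fintype.card_fin]; omega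
    exact ⟨MPt Ls, MLn Ls, inferInstance, inferInstance, inferInstance, planeOfMOLS hL hO hn hι,
      order_planeOfMOLS hL hO hn hι⟩

/-- **`N(10) = 9 ⇔ PP(10)`:** nine pairwise orthogonal Latin squares of order 10 exist iff a projective plane of order 10 does. -/
theorem nine_MOLS10_iff_plane10 :
    (∃ Ls : Fin 9 → Fin 10 → Fin 10 → Fin 10, (∀ k, IsLatinSquare (Ls k)) ∧ ∀ k k', k ≠ k' → IsOrthogonalMate (Ls k) (Ls k')) ↔
      ExistsProjectivePlaneOrder 10 :=
  (existsPlane_iff_MOLS (n := 10) (by norm_num)).symm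

/-- **The MOLS(10) upper floor modulo Lam:** if there is no projective plane of order 10 then any family of pairwise orthogonal
Latin squares of order 10 has at most 8 members. -/
theorem card_MOLS10_le_eight_of_noPlane10 (hLam : ¬ ExistsProjectivePlaneOrder 10) {ι : Type*} [Fintype ι]
    (Ls : ι → Fin 10 → Fin 10 → Fin 10) (hL : ∀ k, IsLatinSquare (Ls k)) (hO : ∀ k k', k ≠ k' → IsOrthogonalMate (Ls k) (Ls k')) :
    Fintype.card ι ≤ 8 := by
  classical
  have h9 : Fintype.card ι ≤ 9 := card_MOLS_le Ls hL hO (by norm_num)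
  by_contra hlt
  have hcard : Fintype.card ι = 9 := by omega
  -- reindex by `Fin 9`
  obtain ⟨e⟩ : Nonempty (Fin 9 ≃ ι) := by
    rw [← hcard]; exact ⟨(Fintype.equivFin ι).symm⟩
  refine hLam (nine_MOLS10_iff_plane10.1 ⟨fun k => Ls (e k), fun k => hL _, fun k k' hkk => hO _ _ ?_⟩)
  exact fun h => hkk (e.injective h)

/-- the same for order 12 with the census statement: if there is no projective plane of order 12, at most 10 MOLS(12) exist
(the record is `5 ≤ N(12)`, `FiveMOLS12`). -/
theorem card_MOLS12_le_ten_of_noPlane12 (h12 : ¬ ExistsProjectivePlaneOrder12) {ι : Type*} [Fintype ι]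
    (Ls : ι → Fin 12 → Fin 12 → Fin 12) (hL : ∀ k, IsLatinSquare (Ls k)) (hO : ∀ k k', k ≠ k' → IsOrthogonalMate (Ls k) (Ls k')) :
    Fintype.card ι ≤ 10 := by
  classical
  have h11 : Fintype.card ι ≤ 11 := card_MOLS_le Ls hL hO (by norm_num)
  by_contra hlt
  have hcard : Fintype.card ι = 11 := by omega
  obtain ⟨e⟩ : Nonempty (Fin 11 ≃ ι) := by
    rw [← hcard]; exact ⟨(Fintype.equivFin ι).symm⟩
  refine h12 (existsPlaneOrder12_iff_eleven_MOLS.2 ⟨fun k => Ls (e k), fun k => hL _, fun k k' hkk => hO _ _ ?_⟩)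
  exact fun h => hkk (e.injective h)

end Summit.Ventures.DiscreteObjects.MOLS
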